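import Summits.Ventures.HodgeRepro2.T5SU11KernelDerivative
import Summits.Ventures.HodgeRepro2.T5SU11ResolventIterateDerivative

/-!
# The derivative of the composed kernels: `∂_λ K_λ^{∘(n+1)}(t, s) = (2λ − 2)(n + 1) K_λ^{∘(n+2)}(t, s)`

The `(n+1)`-fold composed kernel is `K_λ^{∘(n+1)}(t, s) = (G^I_λ)ⁿ K_λ(·, s)(t)`; BOTH the operator and the source move with
`λ`. Splitting `(G^I_λ)ⁿ k_λ − (G^I_{λ₂})ⁿ k_{λ₂} = (G^I_λ)ⁿ (k_λ − k_{λ₂}) + [(G^I_λ)ⁿ k_{λ₂} − (G^I_{λ₂})ⁿ k_{λ₂}]` and using the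
kernel resolvent identity `k_λ − k_{λ₂} = (μ − μ₂) G^I_λ k_{λ₂}` on `(0, ∞)` (row 5xx) together with the linearity and the
`(0, ∞)`-congruence of the iterates, the first term is `(μ − μ₂) (G^I_λ)^{n+1} k_{λ₂}` and the second is row 569's difference:

* `greenSolI_congr_Ioi`, `iterate_congr_Ioi` — the resolvent and its iterates only see the source on `(0, ∞)`;
* `iterate_const_mul`, `iterate_sub_ground` — **linearity of the iterates** (`W_1` sources for the subtraction);
* `kernel_source_sub_eq` — `K_λ(r, s) − K_{λ₂}(r, s) = (μ − μ₂) G^I_λ K_{λ₂}(·, s)(r)` for `r > 0`;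
* `hasDerivAt_kernel_comp_lam` — **`λ ↦ (G^I_λ)ⁿ K_λ(·, s)(t)` has the derivative `(2λ₂ − 2)(n + 1) (G^I_{λ₂})^{n+1} K_{λ₂}(·, s)(t)`
  at every `λ₂ > 1`** — i.e. `∂_μ K_μ^{∘(n+1)} = (n + 1) K_μ^{∘(n+2)}`.

Nothing is claimed about (N).

Blind lane: Mathlib + the HodgeRepro2 prefix only; no sorry; axioms ⊆ {propext, Classical.choice,
Quot.sound}.
-/

namespace Summit.Ventures.HodgeRepro2.T5SU11KernelCompositionDerivative

open Filter Topology MeasureTheory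
open Set (Ioi Ioc)
open T5SU11Cartan T5SU11SphericalFunction T5SU11SphericalDecay T5SU11RadialGreenKernel T5SU11RadialGreenImproper
  T5SU11KernelDifferenceRegularity T5SU11ResolventGroundStateWeight T5SU11WeightedSpaceGroundState
  T5SU11WeightedSpaceGroundStateOrder T5SU11WeightedSpaceGroundStateIterateDiff T5SU11ResolventIterateDerivative
  T5SU11KernelDerivative

/-- **The resolvent only sees the source on `(0, ∞)`**: `G^I f (t) = G^I g (t)` for `t > 0` when `f = g` on `(0, ∞)`. -/
theorem greenSolI_congr_Ioi (φ χ : ℝ → ℝ) {f g : ℝ → ℝ} (hfg : ∀ r, 0 < r → f r = g r) {t : ℝ} (ht : 0 < t) :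
    greenSolI φ χ f t = greenSolI φ χ g t := by
  unfold greenSolI greenBI greenAI
  have e1 : ∫ r in Ioc 0 t, φ r * f r * Real.sinh (2 * r) = ∫ r in Ioc 0 t, φ r * g r * Real.sinh (2 * r) :=
    setIntegral_congr_fun measurableSet_Ioc (fun r hr => by rw [hfg r hr.1])
  have e2 : ∫ r in Ioi t, χ r * f r * Real.sinh (2 * r) = ∫ r in Ioi t, χ r * g r * Real.sinh (2 * r) :=
    setIntegral_congr_fun measurableSet_Ioi (fun r hr => by rw [hfg r (lt_trans ht hr)])
  rw [e1, e2]

/-- **The iterates only see the source on `(0, ∞)`.** -/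
theorem iterate_congr_Ioi (φ χ : ℝ → ℝ) {f g : ℝ → ℝ} (hfg : ∀ r, 0 < r → f r = g r) (n : ℕ) :
    ∀ t, 0 < t → ((greenSolI φ χ)^[n] f) t = ((greenSolI φ χ)^[n] g) t := by
  induction n with
  | zero => intro t ht; exact hfg t ht
  | succ n ih =>
    intro t ht
    rw [Function.iterate_succ_apply', Function.iterate_succ_apply']
    exact greenSolI_congr_Ioi φ χ (fun r hr => ih r hr) ht

/-- **The iterates are homogeneous**: `(G^I)ⁿ (c f) = c (G^I)ⁿ f` (as functions). -/
theorem iterate_const_mul (φ χ f : ℝ → ℝ) (c : ℝ) (n : ℕ) :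
    (greenSolI φ χ)^[n] (fun r => c * f r) = fun t => c * ((greenSolI φ χ)^[n] f) t := by
  induction n with
  | zero => rfl
  | succ n ih =>
    rw [Function.iterate_succ_apply', Function.iterate_succ_apply', ih]
    funext t
    exact greenSolI_const_mul_source φ χ _ c t

section measure

variable [MeasurableSpace Circle] [BorelSpace Circle]

variable {lam : ℝ} (hlam : 1 < lam)

include hlam in
/-- **The iterates are additive on `W_1`**: `(G^I_λ)ⁿ (f − g) = (G^I_λ)ⁿ f − (G^I_λ)ⁿ g` on `(0, ∞)` for `f, g ∈ W_1`. -/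
theorem iterate_sub_ground {f g : ℝ → ℝ} (hf : ContinuousOn f (Ioi 0)) (hg : ContinuousOn g (Ioi 0))
    {D₁ D₂ : ℝ} (hD₁ : ∀ s, 0 < s → |f s| ≤ D₁ * sph 1 (hyp s)) (hD₂ : ∀ s, 0 < s → |g s| ≤ D₂ * sph 1 (hyp s)) (n : ℕ) :
    ∀ t, 0 < t → ((greenSolI (fun t => sph lam (hyp t)) (sphDecay lam))^[n] (fun r => f r - g r)) t
      = ((greenSolI (fun t => sph lam (hyp t)) (sphDecay lam))^[n] f) t
        - ((greenSolI (fun t => sph lam (hyp t)) (sphDecay lam))^[n] g) t := by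
  induction n with
  | zero => intro t _; rfl
  | succ n ih =>
    intro t ht
    obtain ⟨hcf, hbf⟩ := iterate_mem_weighted_one hlam hf hD₁ n
    obtain ⟨hcg, hbg⟩ := iterate_mem_weighted_one hlam hg hD₂ n
    have hDf : ∀ s, 0 < s → |((greenSolI (fun t => sph lam (hyp t)) (sphDecay lam))^[n] f) s|
        ≤ (D₁ / ((lam - 1) ^ 2) ^ n) * sph 1 (hyp s) := fun s hs => by rw [div_mul_eq_mul_div]; exact hbf s hs
    have hDg : ∀ s, 0 < s → |((greenSolI (fun t => sph lam (hyp t)) (sphDecay lam))^[n] g) s|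
        ≤ (D₂ / ((lam - 1) ^ 2) ^ n) * sph 1 (hyp s) := fun s hs => by rw [div_mul_eq_mul_div]; exact hbg s hs
    rw [Function.iterate_succ_apply', Function.iterate_succ_apply', Function.iterate_succ_apply',
      greenSolI_congr_Ioi (fun t => sph lam (hyp t)) (sphDecay lam) (fun r hr => ih r hr) ht]
    exact greenSolI_sub_ground hlam hcf hcg hDf hDg ht

variable {lam₂ : ℝ} (hlam₂ : 1 < lam₂) {s : ℝ} (hs : 0 < s)

include hlam hlam₂ hs in
/-- **The kernel sources differ by `(μ − μ₂) G^I_λ K_{λ₂}(·, s)`** on `(0, ∞)`. -/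
theorem kernel_source_sub_eq {r : ℝ} (hr : 0 < r) :
    sphGreenKernel lam r s - sphGreenKernel lam₂ r s
      = (lam * (lam - 2) - lam₂ * (lam₂ - 2))
        * greenSolI (fun t => sph lam (hyp t)) (sphDecay lam) (fun r => sphGreenKernel lam₂ r s) r := by
  rcases eq_or_ne lam lam₂ with heq | hne
  · subst heq; simp
  · have hμne : lam * (lam - 2) - lam₂ * (lam₂ - 2) ≠ 0 := by
      have e : lam * (lam - 2) - lam₂ * (lam₂ - 2) = (lam - lam₂) * (lam + lam₂ - 2) := by ring
      rw [e]
      exact mul_ne_zero (sub_ne_zero.mpr hne) (by linarith)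
    rw [greenSolI_kernel_eq hlam hlam₂ hs hne hr, mul_div_cancel₀ _ hμne]

include hlam₂ hs in
/-- **THE DERIVATIVE OF THE COMPOSED KERNELS**: `λ ↦ (G^I_λ)ⁿ K_λ(·, s)(t) = K_λ^{∘(n+1)}(t, s)` has the derivative
`(2λ₂ − 2) · (n + 1) · (G^I_{λ₂})^{n+1} K_{λ₂}(·, s)(t) = (2λ₂ − 2)(n + 1) K_{λ₂}^{∘(n+2)}(t, s)` at every `λ₂ > 1` (`t > 0`). -/
theorem hasDerivAt_kernel_comp_lam (n : ℕ) {t : ℝ} (ht : 0 < t) :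
    HasDerivAt (fun l => ((greenSolI (fun t => sph l (hyp t)) (sphDecay l))^[n] (fun r => sphGreenKernel l r s)) t)
      ((2 * lam₂ - 2) * ((n + 1 : ℕ) * ((greenSolI (fun t => sph lam₂ (hyp t)) (sphDecay lam₂))^[n + 1]
        (fun r => sphGreenKernel lam₂ r s)) t)) lam₂ := by
  obtain ⟨D, _, hD⟩ := kernel_source_mem_weighted_one hlam₂ hs
  have hk := kernel_source_continuousOn hlam₂ hs
  set k : ℝ → ℝ := fun r => sphGreenKernel lam₂ r s with hk_def
  set X := ((greenSolI (fun t => sph lam₂ (hyp t)) (sphDecay lam₂))^[n + 1] k) t with hX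
  rw [hasDerivAt_iff_tendsto_slope]
  -- the two limits: `(l + λ₂ − 2) (G^I_l)^{n+1} k(t) → (2λ₂ − 2) X` and the slope of `l ↦ (G^I_l)ⁿ k(t)` → `(2λ₂ − 2) n X`
  have h1 : Tendsto (fun l => (l + lam₂ - 2) * ((greenSolI (fun t => sph l (hyp t)) (sphDecay l))^[n + 1] k) t)
      (𝓝 lam₂) (𝓝 ((2 * lam₂ - 2) * X)) := by
    have ha : Tendsto (fun l : ℝ => l + lam₂ - 2) (𝓝 lam₂) (𝓝 (lam₂ + lam₂ - 2)) :=
      ((continuous_id.add continuous_const).sub continuous_const).tendsto lam₂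
    have hb := tendsto_iterate_lam hlam₂ hk hD (n + 1) ht
    have hab := ha.mul hb
    rwa [show lam₂ + lam₂ - 2 = 2 * lam₂ - 2 by ring] at hab
  have h2 := (hasDerivAt_iff_tendsto_slope.mp (hasDerivAt_iterate_lam hlam₂ hk hD n ht))
  have hsum := (tendsto_nhdsWithin_of_tendsto_nhds h1).add h2
  refine (hsum.congr' ?_).trans ?_
  · -- the slope of the composed kernel splits into the two terms, for `l > 1`, `l ≠ λ₂`
    have hev : ∀ᶠ l in 𝓝[≠] lam₂, 1 < l := eventually_nhdsWithin_of_eventually_nhds (eventually_gt_nhds hlam₂)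
    filter_upwards [hev, self_mem_nhdsWithin] with l hl hne
    have hne' : l - lam₂ ≠ 0 := sub_ne_zero.mpr (Set.mem_compl_singleton_iff.mp hne)
    simp only [slope_def_field]
    -- `(G^I_l)ⁿ k_l(t) − (G^I_l)ⁿ k(t) = (μ − μ₂) (G^I_l)^{n+1} k(t)`
    obtain ⟨Dl, _, hDl⟩ := kernel_source_mem_weighted_one hl hs
    have hkl := kernel_source_continuousOn hl hs
    have hsplit : ((greenSolI (fun t => sph l (hyp t)) (sphDecay l))^[n] (fun r => sphGreenKernel l r s)) t
        - ((greenSolI (fun t => sph l (hyp t)) (sphDecay l))^[n] k) t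
        = (l * (l - 2) - lam₂ * (lam₂ - 2)) * ((greenSolI (fun t => sph l (hyp t)) (sphDecay l))^[n + 1] k) t := by
      rw [← iterate_sub_ground hl hkl hk hDl hD n t ht]
      have hcongr := iterate_congr_Ioi (fun t => sph l (hyp t)) (sphDecay l)
        (f := fun r => sphGreenKernel l r s - sphGreenKernel lam₂ r s)
        (g := fun r => (l * (l - 2) - lam₂ * (lam₂ - 2)) * greenSolI (fun t => sph l (hyp t)) (sphDecay l) k r)
        (fun r hr => kernel_source_sub_eq hl hlam₂ hs hr) n t ht
      rw [hcongr, iterate_const_mul, Function.iterate_succ_apply]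
    have e : l * (l - 2) - lam₂ * (lam₂ - 2) = (l - lam₂) * (l + lam₂ - 2) := by ring
    have : ((greenSolI (fun t => sph l (hyp t)) (sphDecay l))^[n] (fun r => sphGreenKernel l r s)) t
        - ((greenSolI (fun t => sph lam₂ (hyp t)) (sphDecay lam₂))^[n] k) t
        = ((l * (l - 2) - lam₂ * (lam₂ - 2)) * ((greenSolI (fun t => sph l (hyp t)) (sphDecay l))^[n + 1] k) t)
          + (((greenSolI (fun t => sph l (hyp t)) (sphDecay l))^[n] k) t
            - ((greenSolI (fun t => sph lam₂ (hyp t)) (sphDecay lam₂))^[n] k) t) := by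
      linarith [hsplit]
    rw [this, e]
    field_simp
  · -- `(2λ₂ − 2) X + (2λ₂ − 2) n X = (2λ₂ − 2)(n + 1) X`
    rw [show (2 * lam₂ - 2) * X + (2 * lam₂ - 2) * (n * X) = (2 * lam₂ - 2) * ((n + 1 : ℕ) * X) by push_cast; ring]

end measure

end Summit.Ventures.HodgeRepro2.T5SU11KernelCompositionDerivative
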